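import Literature.AlgebraicTopology.Homotopy.SimplexBallHomeomorph
import Literature.AlgebraicTopology.Homotopy.FibreBundlesCellEuler
import Literature.AlgebraicTopology.SingularHomology.StdSimplexFaces
import Mathlib.Topology.CWComplex.Classical.Finite
import Mathlib.Data.Finset.Sort
import HarnessLib

/-!
# The standard simplex with its faces is a finite CW complex

Topic `Literature/AlgebraicTopology/Homotopy`. The face structure of the standard simplex
`Δˢ = stdSimplex ℝ (Fin (s + 1))` (Mathlib's model of singular simplices) as a classical finite
CW complex in Mathlib's sense (`Topology.CWComplex (univ : Set (StdSimplex s))`, relaxed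
constructor `CWComplex.mkFinite`), absent from Mathlib and the tree (which has lattice cube
complexes, `Literature/Topology/Euclidean/LatticeCubeComplex.lean`, and disc attachments):

* `StdSimplexCW.Face s n` — the `n`-faces (vertex sets of size `n + 1`), `Face.emb` their
  increasing enumeration, `closedFace` / `openFace`, the affine parametrisation `faceMap f : Δⁿ → Δˢ`
  (Mathlib's `stdSimplex.map` along `Face.emb`) and the totalised restriction `faceRestr`;
* `StdSimplexCW.chart f : PartialEquiv (Fin n → ℝ) Δˢ` — the characteristic map of a face:
  cube `[-1,1]ⁿ` → simplex `Δⁿ` by the tree's radial homeomorphism `SimplexBall.toBall`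
  (boundary sphere ↔ boundary of the simplex) → `Δˢ` by `faceMap`; images of the open cube /
  closed cube / sphere = open face / closed face / boundary of the face
  (`chart_image_ball`, `chart_image_closedBall`, `chart_image_sphere`);
* **`StdSimplexCW.instCWComplex`** — the finite CW structure (disjoint open faces; the sphere of
  an `n`-face goes into the closed `(n-1)`-faces `Face.erase`; the top face covers);
* the dictionary: `openCell_eq`, `closedCell_eq`, `cellFrontier_eq`, **`mem_skeletonLT_iff`**
  (`z ∈ skeletonLT m ↔ |support z| ≤ m`), `skeletonLT_eq_stdBoundary` (`Xˢ⁻¹ = ∂Δˢ`), and the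
  cofaces `coface j = Δˢ ∖ {vⱼ}` with `faceMap (coface j) = stdFace j` (the tree's `j`-th coface,
  along which `SingularSimplex.face j` restricts) and `cofaceEquiv : Fin (m+2) ≃ Face (m+1) m`.

Purpose: with `p = Prod.fst : Δˢ × F → Δˢ` the tree's direct-sum theorem for bundles over CW
complexes (`FibreBundlesCellsDirectSum.lean`, Spanier 1981, Ch. 9 Sec. 2 Lemma 2) decomposes
`H_•((∂Δˢ, (Δˢ)ˢ⁻²) × F)` over the cofaces — the additivity behind the boundary formula for the
Künneth classes on `(Δˢ, ∂Δˢ) × F` (Spanier 1981, Ch. 9 Sec. 2, Lemma 14 / Thm. 15 (b)), brick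
(γ2b) of the printed proof of `Literature.AlgebraicTopology.Homotopy.Spanier1981_eulerChar_fibreBundle`.
No named fact is introduced. (Hatcher 2002, §2.1: "`Δⁿ` is a disk"; Ch. 0 p. 5 and §2.1 p. 103:
simplicial / Δ-complex structures are CW structures.)

## References

* A. Hatcher, *Algebraic Topology*, CUP (2002), Ch. 0 p. 5, §2.1 pp. 102–104. [HatcherAT2002]
* E. H. Spanier, *Algebraic Topology*, Springer (1981), Ch. 9, Sec. 2, Lemma 14, Thm. 15. [Spanier1981]
-/

noncomputable section

open Set Metric Topology Function
open Literature.AlgebraicTopology.SingularHomology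

namespace Literature.AlgebraicTopology.Homotopy

namespace StdSimplexCW

variable {s : ℕ}

/-! ### Faces -/

/-- The `n`-dimensional faces of `Δˢ`: sets of `n + 1` vertices. [folklore] -/
def Face (s n : ℕ) : Type := {S : Finset (Fin (s + 1)) // S.card = n + 1}

/-- Faces of a given dimension form a finite type. [folklore] -/
instance (s n : ℕ) : Fintype (Face s n) := by unfold Face; infer_instance

/-- The increasing enumeration of the vertices of a face. [folklore] -/
def Face.emb {n : ℕ} (f : Face s n) : Fin (n + 1) ↪o Fin (s + 1) := f.1.orderEmbOfFin f.2

/-- The range of the enumeration is the vertex set. [folklore] -/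
theorem Face.range_emb {n : ℕ} (f : Face s n) : Set.range f.emb = (f.1 : Set (Fin (s + 1))) :=
  Finset.range_orderEmbOfFin f.1 f.2

/-- Enumerated vertices are vertices. [folklore] -/
theorem Face.emb_mem {n : ℕ} (f : Face s n) (i : Fin (n + 1)) : f.emb i ∈ f.1 :=
  Finset.orderEmbOfFin_mem f.1 f.2 i

/-- Vertices of a face are enumerated. [folklore] -/
theorem Face.mem_iff_exists {n : ℕ} (f : Face s n) {k : Fin (s + 1)} : k ∈ f.1 ↔ ∃ i, f.emb i = k := by
  rw [← Finset.mem_coe, ← f.range_emb, Set.mem_range]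

/-- There are no faces of dimension `> s`. [folklore] -/
theorem Face.isEmpty_of_lt {n : ℕ} (h : s < n) : IsEmpty (Face s n) :=
  ⟨fun f => by
    have h1 : f.1.card ≤ s + 1 := (Finset.card_le_univ f.1).trans_eq (by simp)
    have h2 := f.2
    omega⟩

/-- The closed face `{z | z_k = 0 off f}`. [folklore] -/
def closedFace {n : ℕ} (f : Face s n) : Set (StdSimplex s) := {z | ∀ k, k ∉ f.1 → (z : Fin (s + 1) → ℝ) k = 0}

/-- The open face `{z | z_k = 0 off f, z_k > 0 on f}`. [folklore] -/
def openFace {n : ℕ} (f : Face s n) : Set (StdSimplex s) :=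
  {z | (∀ k, k ∉ f.1 → (z : Fin (s + 1) → ℝ) k = 0) ∧ ∀ k, k ∈ f.1 → 0 < (z : Fin (s + 1) → ℝ) k}

/-- The open face lies in the closed face. [folklore] -/
theorem openFace_subset_closedFace {n : ℕ} (f : Face s n) : openFace f ⊆ closedFace f := fun _ hz => hz.1

/-- The affine parametrisation `Δⁿ → Δˢ` of a face. [folklore] -/
def faceMap {n : ℕ} (f : Face s n) : C(StdSimplex n, StdSimplex s) :=
  ⟨stdSimplex.map f.emb, stdSimplex.continuous_map _⟩

/-- Coordinates of `faceMap` along the face. [folklore] -/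
theorem faceMap_apply_emb {n : ℕ} (f : Face s n) (z : StdSimplex n) (i : Fin (n + 1)) :
    (faceMap f z : Fin (s + 1) → ℝ) (f.emb i) = z i :=
  stdSimplex_map_apply_of_injective f.emb.injective z i

/-- Coordinates of `faceMap` off the face vanish. [folklore] -/
theorem faceMap_apply_of_not_mem {n : ℕ} (f : Face s n) (z : StdSimplex n) {k : Fin (s + 1)} (hk : k ∉ f.1) :
    (faceMap f z : Fin (s + 1) → ℝ) k = 0 :=
  stdSimplex_map_apply_of_not_mem_range z (by rw [f.range_emb]; exact_mod_cast hk)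

/-- `faceMap` is injective. [folklore] -/
theorem faceMap_injective {n : ℕ} (f : Face s n) : Injective (faceMap f) :=
  stdSimplex_map_injective f.emb.injective

/-- `faceMap` lands in the closed face. [folklore] -/
theorem faceMap_mem_closedFace {n : ℕ} (f : Face s n) (z : StdSimplex n) : faceMap f z ∈ closedFace f :=
  fun _ hk => faceMap_apply_of_not_mem f z hk

/-- The restriction of barycentric coordinates to a face, made total by spreading the deficit
uniformly (so that it is the honest restriction on the closed face). [folklore] -/
def faceRestrFun {n : ℕ} (f : Face s n) (z : StdSimplex s) : Fin (n + 1) → ℝ := fun i =>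
  (z : Fin (s + 1) → ℝ) (f.emb i) + (1 - ∑ j, (z : Fin (s + 1) → ℝ) (f.emb j)) / (n + 1)

/-- The enumeration as a `Finset.map`. [folklore] -/
theorem Face.map_univ_emb {n : ℕ} (f : Face s n) : Finset.univ.map f.emb.toEmbedding = f.1 := by
  ext k
  simp only [Finset.mem_map, Finset.mem_univ, true_and, f.mem_iff_exists]
  rfl

/-- Sums along the enumeration are sums over the vertex set. [folklore] -/
theorem sum_emb_eq {n : ℕ} (f : Face s n) (g : Fin (s + 1) → ℝ) : ∑ j, g (f.emb j) = ∑ k ∈ f.1, g k := by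
  rw [← f.map_univ_emb, Finset.sum_map]
  rfl

/-- Barycentric coordinates are non-negative. [folklore] -/
theorem coord_nonneg (z : StdSimplex s) (k : Fin (s + 1)) : 0 ≤ (z : Fin (s + 1) → ℝ) k := z.2.1 k

/-- Barycentric coordinates sum to `1`. [folklore] -/
theorem sum_coord (z : StdSimplex s) : ∑ k, (z : Fin (s + 1) → ℝ) k = 1 := z.2.2

/-- The coordinates along a face sum to at most `1`. [folklore] -/
theorem sum_emb_le_one {n : ℕ} (f : Face s n) (z : StdSimplex s) : ∑ j, (z : Fin (s + 1) → ℝ) (f.emb j) ≤ 1 := by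
  rw [sum_emb_eq, ← sum_coord z]
  exact Finset.sum_le_sum_of_subset_of_nonneg (Finset.subset_univ _) fun k _ _ => coord_nonneg z k

/-- On the closed face the coordinates along the face sum to `1`. [folklore] -/
theorem sum_emb_eq_one {n : ℕ} (f : Face s n) {z : StdSimplex s} (hz : z ∈ closedFace f) :
    ∑ j, (z : Fin (s + 1) → ℝ) (f.emb j) = 1 := by
  rw [sum_emb_eq, ← sum_coord z]
  exact Finset.sum_subset (Finset.subset_univ _) fun k _ hk => hz k hk

/-- The totalised restriction lands in the simplex. [folklore] -/
theorem faceRestrFun_mem {n : ℕ} (f : Face s n) (z : StdSimplex s) : faceRestrFun f z ∈ stdSimplex ℝ (Fin (n + 1)) := by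
  have hdef : 0 ≤ 1 - ∑ j, (z : Fin (s + 1) → ℝ) (f.emb j) := sub_nonneg.2 (sum_emb_le_one f z)
  refine ⟨fun i => add_nonneg (coord_nonneg z _) (div_nonneg hdef (by positivity)), ?_⟩
  simp only [faceRestrFun, Finset.sum_add_distrib, Finset.sum_const, Finset.card_univ, Fintype.card_fin,
    nsmul_eq_mul]
  field_simp
  push_cast
  ring

/-- The (totalised) restriction `Δˢ → Δⁿ` to a face. [folklore] -/
def faceRestr {n : ℕ} (f : Face s n) : C(StdSimplex s, StdSimplex n) :=
  ⟨fun z => ⟨faceRestrFun f z, faceRestrFun_mem f z⟩, by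
    refine Continuous.subtype_mk (continuous_pi fun i => ?_) _
    have hc : ∀ k, Continuous fun z : StdSimplex s => (z : Fin (s + 1) → ℝ) k := fun k =>
      (continuous_apply k).comp continuous_subtype_val
    exact (hc _).add ((continuous_const.sub (continuous_finsetSum _ fun j _ => hc _)).div_const _)⟩

/-- On the closed face the restriction is honest. [folklore] -/
theorem faceRestr_apply_of_mem {n : ℕ} (f : Face s n) {z : StdSimplex s} (hz : z ∈ closedFace f) (i : Fin (n + 1)) :
    (faceRestr f z : Fin (n + 1) → ℝ) i = (z : Fin (s + 1) → ℝ) (f.emb i) := by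
  show faceRestrFun f z i = _
  rw [faceRestrFun, sum_emb_eq_one f hz, sub_self, zero_div, add_zero]

/-- `faceRestr ∘ faceMap = id`. [folklore] -/
theorem faceRestr_faceMap {n : ℕ} (f : Face s n) (z : StdSimplex n) : faceRestr f (faceMap f z) = z := by
  ext i
  rw [faceRestr_apply_of_mem f (faceMap_mem_closedFace f z), faceMap_apply_emb]

/-- `faceMap ∘ faceRestr = id` on the closed face. [folklore] -/
theorem faceMap_faceRestr {n : ℕ} (f : Face s n) {z : StdSimplex s} (hz : z ∈ closedFace f) :
    faceMap f (faceRestr f z) = z := by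
  ext k
  by_cases hk : k ∈ f.1
  · obtain ⟨i, rfl⟩ := f.mem_iff_exists.1 hk
    rw [faceMap_apply_emb, faceRestr_apply_of_mem f hz]
  · rw [faceMap_apply_of_not_mem f _ hk, hz k hk]

/-- The closed face is the image of `faceMap`. [folklore] -/
theorem range_faceMap {n : ℕ} (f : Face s n) : Set.range (faceMap f) = closedFace f :=
  Set.ext fun z => ⟨fun ⟨y, hy⟩ => hy ▸ faceMap_mem_closedFace f y, fun hz => ⟨faceRestr f z, faceMap_faceRestr f hz⟩⟩

/-- `faceMap` of an interior point is in the open face, and conversely. [folklore] -/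
theorem faceMap_mem_openFace_iff {n : ℕ} (f : Face s n) (z : StdSimplex n) :
    faceMap f z ∈ openFace f ↔ ∀ i, 0 < (z : Fin (n + 1) → ℝ) i := by
  constructor
  · intro h i
    have := h.2 (f.emb i) (f.emb_mem i)
    rwa [faceMap_apply_emb] at this
  · intro h
    refine ⟨faceMap_mem_closedFace f z, fun k hk => ?_⟩
    obtain ⟨i, rfl⟩ := f.mem_iff_exists.1 hk
    rw [faceMap_apply_emb]
    exact h i


/-! ### Characteristic maps -/

section Chart

variable {n : ℕ}

/-- The characteristic map of a face: cube → ball (radial clamp) → `Δⁿ` (`SimplexBall.toBall⁻¹`)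
→ `Δˢ` (`faceMap`). [folklore] -/
def chartFun (f : Face s n) (y : Fin n → ℝ) : StdSimplex s :=
  faceMap f ((SimplexBall.toBall n).symm ⟨(max 1 ‖y‖)⁻¹ • y, IsFibreBundleWith.ballProj_mem y⟩)

/-- The characteristic map is continuous. [folklore] -/
theorem continuous_chartFun (f : Face s n) : Continuous (chartFun f) :=
  (faceMap f).continuous.comp ((SimplexBall.toBall n).symm.continuous.comp (IsFibreBundleWith.continuous_ballProj.subtype_mk _))

/-- Its inverse: restrict to the face, then `SimplexBall.toBall`. [folklore] -/
def chartInv (f : Face s n) (z : StdSimplex s) : Fin n → ℝ := (SimplexBall.toBall n (faceRestr f z) : Fin n → ℝ)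

/-- Its inverse is continuous. [folklore] -/
theorem continuous_chartInv (f : Face s n) : Continuous (chartInv f) :=
  continuous_subtype_val.comp ((SimplexBall.toBall n).continuous.comp (faceRestr f).continuous)

/-- The inverse lands in the closed cube. [folklore] -/
theorem chartInv_mem_closedBall (f : Face s n) (z : StdSimplex s) : chartInv f z ∈ closedBall (0 : Fin n → ℝ) 1 :=
  (SimplexBall.toBall n (faceRestr f z)).2

/-- On the closed cube no clamping occurs. [folklore] -/
theorem chartFun_of_mem (f : Face s n) {y : Fin n → ℝ} (hy : y ∈ closedBall (0 : Fin n → ℝ) 1) :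
    chartFun f y = faceMap f ((SimplexBall.toBall n).symm ⟨y, hy⟩) := by
  rw [chartFun]
  congr 2
  exact Subtype.ext (IsFibreBundleWith.ballProj_of_mem hy)

/-- `chartFun ∘ chartInv = id` on the closed face. [folklore] -/
theorem chartFun_chartInv (f : Face s n) {z : StdSimplex s} (hz : z ∈ closedFace f) : chartFun f (chartInv f z) = z := by
  rw [chartFun_of_mem f (chartInv_mem_closedBall f z)]
  unfold chartInv
  rw [show (⟨((SimplexBall.toBall n) (faceRestr f z) : Fin n → ℝ), chartInv_mem_closedBall f z⟩ :
      closedBall (0 : Fin n → ℝ) 1) = SimplexBall.toBall n (faceRestr f z) from Subtype.ext rfl,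
    Homeomorph.symm_apply_apply, faceMap_faceRestr f hz]

/-- `chartInv ∘ chartFun = id` on the closed ball. [folklore] -/
theorem chartInv_chartFun (f : Face s n) {y : Fin n → ℝ} (hy : y ∈ closedBall (0 : Fin n → ℝ) 1) :
    chartInv f (chartFun f y) = y := by
  unfold chartInv
  rw [chartFun_of_mem f hy, faceRestr_faceMap, Homeomorph.apply_symm_apply]

/-- The characteristic map lands in the closed face. [folklore] -/
theorem chartFun_mem_closedFace (f : Face s n) (y : Fin n → ℝ) : chartFun f y ∈ closedFace f :=
  faceMap_mem_closedFace f _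

/-- The open cube goes to the open face. [folklore] -/
theorem chartFun_mem_openFace (f : Face s n) {y : Fin n → ℝ} (hy : y ∈ ball (0 : Fin n → ℝ) 1) :
    chartFun f y ∈ openFace f := by
  rw [chartFun_of_mem f (ball_subset_closedBall hy), faceMap_mem_openFace_iff]
  intro i
  refine lt_of_le_of_ne (coord_nonneg _ i) fun h => ?_
  have hsph : ((⟨y, ball_subset_closedBall hy⟩ : closedBall (0 : Fin n → ℝ) 1) : Fin n → ℝ) ∈ sphere (0 : Fin n → ℝ) 1 :=
    (SimplexBall.exists_toBall_symm_apply_eq_zero_iff n _).1 ⟨i, h.symm⟩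
  rw [mem_sphere_zero_iff_norm] at hsph
  have := mem_ball_zero_iff.1 hy
  exact absurd hsph (ne_of_lt this)

/-- The open face comes from the open cube. [folklore] -/
theorem chartInv_mem_ball (f : Face s n) {z : StdSimplex s} (hz : z ∈ openFace f) :
    chartInv f z ∈ ball (0 : Fin n → ℝ) 1 := by
  have hpos : ∀ i, 0 < (faceRestr f z : Fin (n + 1) → ℝ) i := fun i => by
    rw [faceRestr_apply_of_mem f hz.1]
    exact hz.2 _ (f.emb_mem i)
  rcases (mem_closedBall_zero_iff.1 (chartInv_mem_closedBall f z)).lt_or_eq with h | h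
  · exact mem_ball_zero_iff.2 h
  · exfalso
    obtain ⟨i, hi⟩ := (SimplexBall.toBall_mem_sphere_iff n (faceRestr f z)).1 (mem_sphere_zero_iff_norm.2 h)
    exact (hpos i).ne' hi

/-- Boundary points of the face come from the sphere. [folklore] -/
theorem chartInv_mem_sphere (f : Face s n) {z : StdSimplex s} (hz : z ∈ closedFace f) {i : Fin (n + 1)}
    (hi : (z : Fin (s + 1) → ℝ) (f.emb i) = 0) : chartInv f z ∈ sphere (0 : Fin n → ℝ) 1 :=
  (SimplexBall.toBall_mem_sphere_iff n (faceRestr f z)).2 ⟨i, by rw [faceRestr_apply_of_mem f hz, hi]⟩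

/-- **The characteristic map of a face as a partial equivalence `ball ≃ open face`.** [folklore] -/
def chart (f : Face s n) : PartialEquiv (Fin n → ℝ) (StdSimplex s) where
  toFun := chartFun f
  invFun := chartInv f
  source := ball 0 1
  target := openFace f
  map_source' _ hy := chartFun_mem_openFace f hy
  map_target' _ hz := chartInv_mem_ball f hz
  left_inv' _ hy := chartInv_chartFun f (ball_subset_closedBall hy)
  right_inv' _ hz := chartFun_chartInv f hz.1

/-- The image of the open cube is the open face. [folklore] -/
theorem chart_image_ball (f : Face s n) : chart f '' ball (0 : Fin n → ℝ) 1 = openFace f :=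
  (chart f).image_source_eq_target

/-- The image of the closed cube is the closed face. [folklore] -/
theorem chart_image_closedBall (f : Face s n) : chart f '' closedBall (0 : Fin n → ℝ) 1 = closedFace f := by
  refine Set.ext fun z => ⟨?_, fun hz => ⟨chartInv f z, chartInv_mem_closedBall f z, chartFun_chartInv f hz⟩⟩
  rintro ⟨y, -, rfl⟩
  exact chartFun_mem_closedFace f y

/-- The image of the sphere is the boundary of the face. [folklore] -/
theorem chart_image_sphere (f : Face s n) :
    chart f '' sphere (0 : Fin n → ℝ) 1 = closedFace f ∩ {z | ∃ i, (z : Fin (s + 1) → ℝ) (f.emb i) = 0} := by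
  refine Set.ext fun z => ⟨?_, ?_⟩
  · rintro ⟨y, hy, rfl⟩
    refine ⟨chartFun_mem_closedFace f y, ?_⟩
    obtain ⟨i, hi⟩ := (SimplexBall.exists_toBall_symm_apply_eq_zero_iff n ⟨y, sphere_subset_closedBall hy⟩).2 hy
    refine ⟨i, ?_⟩
    show (chartFun f y : Fin (s + 1) → ℝ) (f.emb i) = 0
    rw [chartFun_of_mem f (sphere_subset_closedBall hy), faceMap_apply_emb]
    exact hi
  · rintro ⟨hz, i, hi⟩
    exact ⟨chartInv f z, chartInv_mem_sphere f hz hi, chartFun_chartInv f hz⟩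

end Chart

/-! ### The CW structure -/

/-- Distinct faces have disjoint open faces. [folklore] -/
theorem eq_of_mem_openFace {n m : ℕ} {f : Face s n} {g : Face s m} {z : StdSimplex s} (hf : z ∈ openFace f)
    (hg : z ∈ openFace g) : (⟨n, f⟩ : Σ n, Face s n) = ⟨m, g⟩ := by
  have h1 : f.1 = g.1 := by
    ext k
    constructor
    · intro hk
      by_contra hk'
      exact (hf.2 k hk).ne' (hg.1 k hk')
    · intro hk
      by_contra hk'
      exact (hg.2 k hk).ne' (hf.1 k hk')
  obtain rfl : n = m := by
    have := f.2; have := g.2; rw [h1] at *; omega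
  have : f = g := Subtype.ext h1
  rw [this]

/-- The top face. [folklore] -/
def topFace (s : ℕ) : Face s s := ⟨Finset.univ, by simp⟩

/-- The closed top face is everything. [folklore] -/
theorem closedFace_topFace : closedFace (topFace s) = univ :=
  eq_univ_of_forall fun _ _ hk => absurd (Finset.mem_univ _) hk

/-- Deleting a vertex of a positive-dimensional face. [folklore] -/
def Face.erase {n : ℕ} (f : Face s (n + 1)) (i : Fin (n + 2)) : Face s n :=
  ⟨f.1.erase (f.emb i), by rw [Finset.card_erase_of_mem (f.emb_mem i), f.2]; rfl⟩

/-- **The standard simplex `Δˢ` with its faces is a finite CW complex** (cells: the open faces;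
characteristic maps: cube → simplex onto the closed faces). [folklore] -/
instance instCWComplex (s : ℕ) : CWComplex (univ : Set (StdSimplex s)) :=
  CWComplex.mkFinite (univ : Set (StdSimplex s)) (fun n => Face s n) (fun _ f => chart f)
    (Filter.eventually_atTop.2 ⟨s + 1, fun _ hn => Face.isEmpty_of_lt (by omega)⟩)
    (fun _ => inferInstance)
    (fun _ _ => rfl)
    (fun _ f => (continuous_chartFun f).continuousOn)
    (fun _ f => (continuous_chartInv f).continuousOn)
    (by
      rintro ⟨n, f⟩ - ⟨m, g⟩ - hne
      refine Set.disjoint_left.2 fun z hzf hzg => hne ?_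
      change z ∈ chart f '' ball 0 1 at hzf
      change z ∈ chart g '' ball 0 1 at hzg
      rw [chart_image_ball] at hzf hzg
      exact eq_of_mem_openFace hzf hzg)
    (by
      intro n f y hy
      cases n with
      | zero =>
        exfalso
        have h1 : ‖y‖ = 1 := mem_sphere_zero_iff_norm.1 hy
        have h0 : ‖y‖ = 0 := by rw [Subsingleton.elim y 0, norm_zero]
        linarith
      | succ n =>
        obtain ⟨i, hi⟩ := (SimplexBall.exists_toBall_symm_apply_eq_zero_iff (n + 1)
          ⟨y, sphere_subset_closedBall hy⟩).2 hy
        refine mem_iUnion₂.2 ⟨n, Nat.lt_succ_self n, mem_iUnion.2 ⟨f.erase i, ?_⟩⟩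
        change chartFun f y ∈ chart (f.erase i) '' closedBall 0 1
        rw [chart_image_closedBall]
        intro k hk
        by_cases hkf : k ∈ f.1
        · obtain ⟨i', rfl⟩ := f.mem_iff_exists.1 hkf
          have hii' : i' = i := by
            by_contra h
            exact hk (Finset.mem_erase.2 ⟨fun h' => h (f.emb.injective h'), f.emb_mem i'⟩)
          subst hii'
          rw [chartFun_of_mem f (sphere_subset_closedBall hy), faceMap_apply_emb]
          exact hi
        · exact chartFun_mem_closedFace f y k hkf)
    (by
      refine eq_univ_of_forall fun z => mem_iUnion₂.2 ⟨s, topFace s, ?_⟩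
      rw [chart_image_closedBall, closedFace_topFace]
      exact mem_univ z)


/-! ### Cells, skeleta and cofaces -/

section Cells

open RelCWComplex

variable {n : ℕ}

/-- The characteristic maps of the CW structure are the charts. [folklore] -/
theorem map_eq (f : Face s n) : map (C := (univ : Set (StdSimplex s))) n f = chart f := rfl

/-- **The open cells are the open faces.** [folklore] -/
theorem openCell_eq (f : Face s n) : openCell (C := (univ : Set (StdSimplex s))) n f = openFace f :=
  chart_image_ball f

/-- **The closed cells are the closed faces.** [folklore] -/
theorem closedCell_eq (f : Face s n) : closedCell (C := (univ : Set (StdSimplex s))) n f = closedFace f :=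
  chart_image_closedBall f

/-- **The cell frontiers are the boundaries of the faces.** [folklore] -/
theorem cellFrontier_eq (f : Face s n) : cellFrontier (C := (univ : Set (StdSimplex s))) n f =
    closedFace f ∩ {z | ∃ i, (z : Fin (s + 1) → ℝ) (f.emb i) = 0} :=
  chart_image_sphere f

/-- The support of a point: the vertices with positive coordinate. [folklore] -/
def support (z : StdSimplex s) : Finset (Fin (s + 1)) := Finset.univ.filter fun k => (z : Fin (s + 1) → ℝ) k ≠ 0

/-- Membership in the support. [folklore] -/
theorem mem_support_iff {z : StdSimplex s} {k : Fin (s + 1)} : k ∈ support z ↔ (z : Fin (s + 1) → ℝ) k ≠ 0 := by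
  simp [support]

/-- The support is nonempty (coordinates sum to `1`). [folklore] -/
theorem support_nonempty (z : StdSimplex s) : (support z).Nonempty := by
  by_contra h
  rw [Finset.not_nonempty_iff_eq_empty] at h
  have h0 : ∀ k, (z : Fin (s + 1) → ℝ) k = 0 := fun k => by
    by_contra hk
    have : k ∈ support z := mem_support_iff.2 hk
    rw [h] at this
    exact absurd this (Finset.notMem_empty k)
  have := sum_coord z
  simp [h0] at this

/-- The face spanned by the support. [folklore] -/
def supportFace (z : StdSimplex s) : Face s ((support z).card - 1) :=
  ⟨support z, (Nat.sub_add_cancel (Finset.card_pos.2 (support_nonempty z))).symm⟩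

/-- A point lies in the open face of its support. [folklore] -/
theorem mem_openFace_supportFace (z : StdSimplex s) : z ∈ openFace (supportFace z) :=
  ⟨fun k hk => by simpa [supportFace, mem_support_iff] using hk,
    fun k hk => lt_of_le_of_ne (coord_nonneg z k) (Ne.symm (by simpa [supportFace, mem_support_iff] using hk))⟩

/-- The open face containing a point is that of its support. [folklore] -/
theorem eq_support_of_mem_openFace {f : Face s n} {z : StdSimplex s} (hz : z ∈ openFace f) : f.1 = support z := by
  ext k
  rw [mem_support_iff]
  exact ⟨fun hk => (hz.2 k hk).ne', fun hk => by by_contra h; exact hk (hz.1 k h)⟩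

/-- **The skeleta of the simplex**: `z` lies in `skeletonLT m` iff its support has at most `m`
vertices (i.e. `z` lies in an open face of dimension `< m`). [folklore] -/
theorem mem_skeletonLT_iff {m : ℕ} {z : StdSimplex s} :
    z ∈ (skeletonLT (univ : Set (StdSimplex s)) (m : ℕ∞) : Set (StdSimplex s)) ↔ (support z).card ≤ m := by
  rw [SetLike.mem_coe, CWComplex.mem_skeletonLT_iff]
  constructor
  · rintro ⟨n, hn, f, hf⟩
    rw [openCell_eq] at hf
    have h1 := eq_support_of_mem_openFace hf
    have h2 := f.2
    rw [h1] at h2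
    have hn' : n < m := by exact_mod_cast hn
    omega
  · intro h
    have hpos := Finset.card_pos.2 (support_nonempty z)
    refine ⟨(support z).card - 1, by exact_mod_cast (by omega : (support z).card - 1 < m), supportFace z, ?_⟩
    rw [openCell_eq]
    exact mem_openFace_supportFace z

/-- **The `(s-1)`-skeleton is the boundary** `∂Δˢ = {z | ∃ i, zᵢ = 0}`. [folklore] -/
theorem skeletonLT_eq_stdBoundary :
    (skeletonLT (univ : Set (StdSimplex s)) (s : ℕ∞) : Set (StdSimplex s)) = stdBoundary s := by
  ext z
  rw [mem_skeletonLT_iff, mem_stdBoundary_iff]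
  constructor
  · intro h
    by_contra h'
    have h'' : ∀ k, (z : Fin (s + 1) → ℝ) k ≠ 0 := fun k hk => h' ⟨k, hk⟩
    have : support z = Finset.univ := Finset.eq_univ_of_forall fun k => mem_support_iff.2 (h'' k)
    rw [this, Finset.card_univ, Fintype.card_fin] at h
    omega
  · rintro ⟨i, hi⟩
    have : support z ⊆ Finset.univ.erase i := fun k hk =>
      Finset.mem_erase.2 ⟨fun h => (mem_support_iff.1 hk) (h ▸ hi), Finset.mem_univ k⟩
    have := Finset.card_le_card this
    rw [Finset.card_erase_of_mem (Finset.mem_univ i), Finset.card_univ, Fintype.card_fin] at this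
    omega

/-- The coface opposite to the vertex `j`: all vertices but `j`. [folklore] -/
def coface {m : ℕ} (j : Fin (m + 2)) : Face (m + 1) m :=
  ⟨Finset.univ.erase j, by rw [Finset.card_erase_of_mem (Finset.mem_univ j), Finset.card_univ, Fintype.card_fin]; rfl⟩

/-- Its increasing enumeration is `Fin.succAbove j`. [folklore] -/
theorem coface_emb {m : ℕ} (j : Fin (m + 2)) : (coface j).emb = Fin.succAboveOrderEmb j := by
  symm
  apply Finset.orderEmbOfFin_unique'
  intro x
  simp [coface, Fin.succAboveOrderEmb]

/-- The enumeration of a coface, applied. [folklore] -/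
theorem coface_emb_apply {m : ℕ} (j : Fin (m + 2)) (i : Fin (m + 1)) : (coface j).emb i = j.succAbove i := by
  rw [coface_emb]; rfl

/-- **The parametrisation of a coface is the coface map `stdFace j`.** [folklore] -/
theorem faceMap_coface {m : ℕ} (j : Fin (m + 2)) : faceMap (coface j) = stdFace j := by
  ext z k
  simp only [faceMap, coface_emb, ContinuousMap.coe_mk, stdFace_apply]
  rfl

/-- The closed coface is the image of `stdFace j`. [folklore] -/
theorem closedFace_coface {m : ℕ} (j : Fin (m + 2)) : closedFace (coface j) = Set.range (stdFace (n := m) j) := by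
  rw [← range_faceMap, faceMap_coface]

/-- The closed coface opposite `j` is `{z | zⱼ = 0}`. [folklore] -/
theorem mem_closedFace_coface_iff {m : ℕ} (j : Fin (m + 2)) {z : StdSimplex (m + 1)} :
    z ∈ closedFace (coface j) ↔ (z : Fin (m + 2) → ℝ) j = 0 := by
  simp only [closedFace, coface, mem_setOf_eq, Finset.mem_erase, Finset.mem_univ, and_true, not_not]
  exact ⟨fun h => h j rfl, fun h k hk => hk ▸ h⟩

/-- Every `m`-face of `Δᵐ⁺¹` is a coface. [folklore] -/
theorem exists_coface_eq {m : ℕ} (f : Face (m + 1) m) : ∃ j, coface j = f := by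
  have hcard : (Finset.univ \ f.1).card = 1 := by
    rw [Finset.card_sdiff_of_subset (Finset.subset_univ _), Finset.card_univ, Fintype.card_fin, f.2]
    omega
  obtain ⟨j, hj⟩ := Finset.card_eq_one.1 hcard
  refine ⟨j, Subtype.ext ?_⟩
  show Finset.univ.erase j = f.1
  ext k
  rw [Finset.mem_erase]
  have hk : k ∈ Finset.univ \ f.1 ↔ k = j := by rw [hj, Finset.mem_singleton]
  rw [Finset.mem_sdiff] at hk
  simp only [Finset.mem_univ, true_and] at hk ⊢
  tauto

/-- The cofaces `Fin (m+2) ≃ Face (m+1) m`. [folklore] -/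
def cofaceEquiv (m : ℕ) : Fin (m + 2) ≃ Face (m + 1) m :=
  Equiv.ofBijective coface ⟨fun j j' h => by
    have := congrArg (fun f : Face (m + 1) m => f.1) h
    simp only [coface] at this
    by_contra hne
    have hmem : j' ∈ Finset.univ.erase j := Finset.mem_erase.2 ⟨Ne.symm hne, Finset.mem_univ _⟩
    rw [this] at hmem
    exact (Finset.mem_erase.1 hmem).1 rfl, exists_coface_eq⟩

/-- `cofaceEquiv` is `coface`. [folklore] -/
@[simp] theorem cofaceEquiv_apply (m : ℕ) (j : Fin (m + 2)) : cofaceEquiv m j = coface j := rfl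

end Cells

end StdSimplexCW

end Literature.AlgebraicTopology.Homotopy
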